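import Literature.NumberTheory.Automorphic.SymplecticSimilitudeSatakeTransform
import Literature.NumberTheory.Automorphic.SatakeTransformIwasawaInjective
import Literature.NumberTheory.Automorphic.SymplecticSimilitudeIwasawaCartan
import Literature.NumberTheory.Automorphic.HyperspecialUnitarySatakeInjective
import HarnessLib

/-!
# The Satake transform of `ℋ(GSp_{2n}(K), GSp_{2n}(𝒪))` is injective, and `𝒮(T_{t(m,a)})` is triangular
# (Andrianov–Zhuravlev Thm. 3.30, injectivity of the spherical map `Ω`; Cartier 1979 Thm. 4.1 via Bruhat–Tits (4.4.4) (i))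

Topic `NumberTheory/Automorphic`; namespace `Literature.NumberTheory.Automorphic.SymplecticCartan` (lane `lit-hodgefound`,
Track 2 foundations; seat `lit-hodgefound-p11`, generation 37, row g37-#14).  THEOREMS ONLY: no definition, no named fact,
no instance, no notation.  Assembles `SymplecticSimilitudeSatakeTransform` (`similitudeSatakeTransform hϖ q : ℋ →ₐ[R] R[ℤⁿ × ℤ]`),
the abstract criterion `SatakeTransformIwasawaInjective` and `SymplecticSimilitudeIwasawaCartan` (Bruhat–Tits (4.4.4) (i) for
`GSp_{2n}` and its Cartan decomposition in the chamber of `B(K)`), with the head-sum refinement of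
`HyperspecialUnitarySatakeInjective` §1.

## The print

[AndrianovZhuravlev1995] Ch. 3 §3.3 Thm. 3.30: the spherical map `Ω : L^n_{0,p} → ℚ[x₀^{±1}, …, x_n^{±1}]` of the Hecke ring of
`GSp_n(ℚ_p)` relative to `GSp_n(ℤ_p)` is an injective ring homomorphism (with image the `W`-invariants — the image is NOT
claimed here); [CartierCorvallis1979] §IV Thm. 4.1 and its proof (b)–(c); [BruhatTits1972] Prop. (4.4.4); [Kottwitz1992] §7
(Case C).  `n ≠ 0` throughout (cosets of `GSp_{2n}`).

## What is formalised (`K` a field with `Valued K ℤᵐ⁰`, uniformiser `ϖ`, `n ≠ 0`; `R` a commutative ring, `q ∈ Rˣ`)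

* §1 the hypotheses of the abstract criterion for the datum `(B(K), GSp(J, 𝒪), similitudeIwasawaExp)` with
  `D = {t(m, a) : a antitone, m + 2aᵢ ≥ 0}` and `φ(μ, c) =` head sums of `μ` in `Lex (Fin n → ℤ)`:
  `exists_dominantTorusElt_mem_orbit` (CARTAN), `injOn_similitudeIwasawaExp_dominantTorusElt` (SEPARATION),
  **`similitudeIwasawaExp_eq_or_headSum_lt`** (DOMINANCE).
* §2 **`similitudeSatakeTransform_injective`** — for `R` a domain of characteristic `0` and any `q ∈ Rˣ`,
  `similitudeSatakeTransform hϖ q` IS INJECTIVE; `eq_zero_of_similitudeSatakeVec_eq_zero`.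
* §3 TRIANGULARITY: `snd_eq_of_coeff_similitudeSatakeTransform_ne_zero` (`x^{(μ, c)}` occurs in `𝒮(T_{t(m,a)})` only if
  `c = m`), **`headSum_le_of_coeff_similitudeSatakeTransform_ne_zero`** (and `Σ_{i<r} μᵢ ≤ Σ_{i<r} (m + aᵢ)` for all `r`),
  `coeff_self_similitudeSatakeTransform_torusElt_ne_zero` (the leading coefficient, that of `x^{(m+a, m)}`, is non-zero).

## References
* [AndrianovZhuravlev1995] A. N. Andrianov, V. G. Zhuravlev, *Modular Forms and Hecke Operators* (1995), Ch. 3 §3.3 Thm. 3.30.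
* [CartierCorvallis1979] P. Cartier, *Representations of 𝔭-adic groups: a survey*, PSPM 33.1 (1979), §IV Thm. 4.1 and proof.
* [BruhatTits1972] F. Bruhat, J. Tits, Publ. Math. IHÉS 41 (1972), Prop. (4.4.4).
* [Kottwitz1992] R. E. Kottwitz, *Points on some Shimura varieties over finite fields*, J. AMS 5 (1992), §7.
-/

noncomputable section

open scoped Valued WithZero MatrixGroups
open Matrix MonoidAlgebra Representation Finset

namespace Literature.NumberTheory.Automorphic.SymplecticCartan

open Literature.NumberTheory.Automorphic.CartanUnique Literature.NumberTheory.Automorphic.HermitianLattice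

variable {K : Type*} [Field K] [Valued K ℤᵐ⁰] {ϖ : K} {n : ℕ} [NeZero n]

/-! ## §1 (CARTAN), (SEPARATION), (DOMINANCE) for `GSp_{2n}` -/

/-- **(CARTAN)**: every coset has some `t(m, a) K₀`, `a` antitone, `m + 2aᵢ ≥ 0`, in its `GSp(J, 𝒪)`-orbit.
[cite: AndrianovZhuravlev1995, Ch. 3 §3 Lemma 3.6] [cite: BruhatTits1972, §4.4 (4.4.3)] -/
theorem exists_dominantTorusElt_mem_orbit (hϖ : Valued.v ϖ = WithZero.exp (-1 : ℤ))
    (γ₀ : symplecticSimilitudeGroup (Fin n) K ⧸ symplecticSimilitudeInt (Fin n) K) :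
    ∃ t ∈ {t : symplecticSimilitudeGroup (Fin n) K | ∃ (m : ℤ) (a : Fin n → ℤ), Antitone a ∧ (∀ i, 0 ≤ m + 2 * a i) ∧
        t = similitudeTorusElt (uniformizer_ne_zero hϖ) m a},
      (t : symplecticSimilitudeGroup (Fin n) K ⧸ symplecticSimilitudeInt (Fin n) K) ∈
        MulAction.orbit (symplecticSimilitudeInt (Fin n) K) γ₀ := by
  obtain ⟨m, a, ha, hm, h⟩ := exists_dominant_similitudeTorusElt_mem_orbit hϖ γ₀
  exact ⟨_, ⟨m, a, ha, hm, rfl⟩, h⟩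

/-- **(SEPARATION)**: `t(m, a) ↦ (a, c)(t(m, a)) = (m + a, m)` is injective on the torus representatives.
[cite: Kottwitz1992, §7 Lemma 7.4] -/
theorem injOn_similitudeIwasawaExp_dominantTorusElt (hϖ : Valued.v ϖ = WithZero.exp (-1 : ℤ)) :
    Set.InjOn (similitudeIwasawaExp hϖ) {t : symplecticSimilitudeGroup (Fin n) K | ∃ (m : ℤ) (a : Fin n → ℤ),
        Antitone a ∧ (∀ i, 0 ≤ m + 2 * a i) ∧ t = similitudeTorusElt (uniformizer_ne_zero hϖ) m a} := by
  rintro _ ⟨m, a, -, -, rfl⟩ _ ⟨m', a', -, -, rfl⟩ h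
  rw [similitudeIwasawaExp_similitudeTorusElt, similitudeIwasawaExp_similitudeTorusElt, Prod.mk.injEq] at h
  obtain ⟨h1, rfl⟩ := h
  have haa' : a = a' := funext fun i => by have := congr_fun h1 i; simp only [add_right_inj] at this; exact this
  subst haa'
  rfl

/-- **(DOMINANCE)** — Bruhat–Tits (4.4.4) (i) for `GSp_{2n}` in the form used by the abstract criterion: for a coset
`γ ⊆ K₀ t(m, a) K₀` (`a` antitone, `m + 2aᵢ ≥ 0`) either `(a, c)(γ) = (a, c)(t(m, a))` or the head-sum vector of `a(γ)` is
lexicographically SMALLER than that of `m + a`. [cite: BruhatTits1972, Prop. (4.4.4) (i)] [cite: CartierCorvallis1979, §IV, proof of Thm. 4.1 (c)] -/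
theorem similitudeIwasawaExp_eq_or_headSum_lt (hϖ : Valued.v ϖ = WithZero.exp (-1 : ℤ)) :
    ∀ t ∈ {t : symplecticSimilitudeGroup (Fin n) K | ∃ (m : ℤ) (a : Fin n → ℤ), Antitone a ∧ (∀ i, 0 ≤ m + 2 * a i) ∧
        t = similitudeTorusElt (uniformizer_ne_zero hϖ) m a},
      ∀ γ ∈ MulAction.orbit (symplecticSimilitudeInt (Fin n) K)
          (t : symplecticSimilitudeGroup (Fin n) K ⧸ symplecticSimilitudeInt (Fin n) K),
        similitudeIwasawaExp hϖ γ.out = similitudeIwasawaExp hϖ t ∨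
          toLex (fun r : Fin n => ∑ i : Fin n, if (i : ℕ) < (r : ℕ) + 1 then (similitudeIwasawaExp hϖ γ.out).1 i else 0) <
            toLex (fun r : Fin n => ∑ i : Fin n, if (i : ℕ) < (r : ℕ) + 1 then (similitudeIwasawaExp hϖ t).1 i else 0) := by
  rintro _ ⟨m, a, ha, hm, rfl⟩ γ hγ
  rw [similitudeIwasawaExp_similitudeTorusElt]
  have hγ' : (γ.out : symplecticSimilitudeGroup (Fin n) K ⧸ symplecticSimilitudeInt (Fin n) K) ∈
      MulAction.orbit (symplecticSimilitudeInt (Fin n) K)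
        ((similitudeTorusElt (uniformizer_ne_zero hϖ) m a : symplecticSimilitudeGroup (Fin n) K) :
          symplecticSimilitudeGroup (Fin n) K ⧸ symplecticSimilitudeInt (Fin n) K) := by
    rwa [QuotientGroup.out_eq']
  have hle : ∀ r : ℕ, (∑ i : Fin n, if (i : ℕ) < r then (similitudeIwasawaExp hϖ γ.out).1 i else 0) ≤
      ∑ i : Fin n, if (i : ℕ) < r then m + a i else 0 := fun r => sum_similitudeIwasawaExp_head_le hϖ ha hm hγ' r
  have hsnd : (similitudeIwasawaExp hϖ γ.out).2 = m := snd_similitudeIwasawaExp_eq_of_mem_orbit hϖ hγ'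
  rcases (toLex_headSum_le_of_forall_le hle).lt_or_eq with hlt | heq
  · exact Or.inr hlt
  · refine Or.inl (Prod.ext ?_ hsnd)
    exact eq_of_forall_le_of_toLex_le hle heq.ge

/-! ## §2 Injectivity -/

variable {R : Type*} [CommRing R]

/-- **THE SATAKE TRANSFORM OF `ℋ(GSp_{2n}(K), GSp_{2n}(𝒪))` IS INJECTIVE** over any domain of characteristic `0`, for every
normalisation `q ∈ Rˣ` — the injectivity of Andrianov–Zhuravlev's spherical map `Ω` (the abstract criterion fed with
(CARTAN), (SEPARATION), (DOMINANCE) above). [cite: AndrianovZhuravlev1995, Ch. 3 §3.3 Thm. 3.30]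
[cite: CartierCorvallis1979, §IV Thm. 4.1] [cite: BruhatTits1972, Prop. (4.4.4) (i)] -/
theorem similitudeSatakeTransform_injective [IsDomain R] [CharZero R] (hϖ : Valued.v ϖ = WithZero.exp (-1 : ℤ)) (q : Rˣ) :
    Function.Injective (similitudeSatakeTransform (n := n) (R := R) hϖ q) :=
  (isIwasawaExponent_similitude hϖ).satakeTransform_injective (similitudeSatakeWeight q)
    (φ := fun μc : (Fin n → ℤ) × ℤ => toLex (fun r : Fin n => ∑ i : Fin n, if (i : ℕ) < (r : ℕ) + 1 then μc.1 i else 0))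
    (exists_dominantTorusElt_mem_orbit hϖ) (injOn_similitudeIwasawaExp_dominantTorusElt hϖ)
    (similitudeIwasawaExp_eq_or_headSum_lt hϖ)

/-- **A non-zero `GSp(J, 𝒪)`-invariant vector has non-zero Satake transform.** [cite: CartierCorvallis1979, §IV Thm. 4.1, proof (b)–(c)] -/
theorem eq_zero_of_similitudeSatakeVec_eq_zero [IsDomain R] [CharZero R] (hϖ : Valued.v ϖ = WithZero.exp (-1 : ℤ))
    (q : Rˣ) {v : MonoidAlgebra R (symplecticSimilitudeGroup (Fin n) K ⧸ symplecticSimilitudeInt (Fin n) K)}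
    (hv : ∀ k ∈ symplecticSimilitudeInt (Fin n) K, ofMulAction R (symplecticSimilitudeGroup (Fin n) K)
      (symplecticSimilitudeGroup (Fin n) K ⧸ symplecticSimilitudeInt (Fin n) K) k v = v)
    (h0 : IsIwasawaExponent.satakeVec (symplecticSimilitudeInt (Fin n) K) (similitudeIwasawaExp hϖ)
      (similitudeSatakeWeight q) v = 0) :
    v = 0 :=
  (isIwasawaExponent_similitude hϖ).eq_zero_of_satakeVec_eq_zero (similitudeSatakeWeight q)
    (φ := fun μc : (Fin n → ℤ) × ℤ => toLex (fun r : Fin n => ∑ i : Fin n, if (i : ℕ) < (r : ℕ) + 1 then μc.1 i else 0))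
    (exists_dominantTorusElt_mem_orbit hϖ) (injOn_similitudeIwasawaExp_dominantTorusElt hϖ)
    (similitudeIwasawaExp_eq_or_headSum_lt hϖ) hv h0

/-! ## §3 Triangularity of `𝒮(T_{t(m, a)})` -/

variable [IsHeckeTriple (⊤ : Submonoid (symplecticSimilitudeGroup (Fin n) K)) (symplecticSimilitudeInt (Fin n) K)
  (symplecticSimilitudeInt (Fin n) K)]

/-- **Triangularity, multiplier part**: if `x^{(μ, c)}` occurs in `𝒮(T_{t(m, a)})` then `c = m` (no condition on `a`).
[cite: AndrianovZhuravlev1995, Ch. 3 §3.3 (3.44)–(3.46)] -/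
theorem snd_eq_of_coeff_similitudeSatakeTransform_ne_zero (hϖ : Valued.v ϖ = WithZero.exp (-1 : ℤ)) (q : Rˣ) (m : ℤ)
    (a : Fin n → ℤ) {μc : (Fin n → ℤ) × ℤ}
    (hμ : (similitudeSatakeTransform hϖ q (heckeAlgebra.doubleCosetOperator (symplecticSimilitudeInt (Fin n) K)
      (similitudeTorusElt (uniformizer_ne_zero hϖ) m a))).coeff μc ≠ 0) : μc.2 = m := by
  by_contra hne
  refine hμ ((isIwasawaExponent_similitude hϖ).coeff_satakeTransform_doubleCosetOperator_eq_zero _ fun γ hγ heq => hne ?_)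
  have hγ' : (γ.out : symplecticSimilitudeGroup (Fin n) K ⧸ symplecticSimilitudeInt (Fin n) K) ∈
      MulAction.orbit (symplecticSimilitudeInt (Fin n) K)
        ((similitudeTorusElt (uniformizer_ne_zero hϖ) m a : symplecticSimilitudeGroup (Fin n) K) :
          symplecticSimilitudeGroup (Fin n) K ⧸ symplecticSimilitudeInt (Fin n) K) := by
    rwa [QuotientGroup.out_eq']
  rw [← heq]
  exact snd_similitudeIwasawaExp_eq_of_mem_orbit hϖ hγ'

/-- **Triangularity**: if `x^{(μ, c)}` occurs in `𝒮(T_{t(m, a)})` (`a` antitone, `m + 2aᵢ ≥ 0`) then `μ` is dominated by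
`m + a`: `Σ_{i<r} μᵢ ≤ Σ_{i<r} (m + aᵢ)` for every `r`. [cite: CartierCorvallis1979, §IV, proof of Thm. 4.1 (c)]
[cite: BruhatTits1972, Prop. (4.4.4) (i)] -/
theorem headSum_le_of_coeff_similitudeSatakeTransform_ne_zero (hϖ : Valued.v ϖ = WithZero.exp (-1 : ℤ)) (q : Rˣ)
    {m : ℤ} {a : Fin n → ℤ} (ha : Antitone a) (hm : ∀ i, 0 ≤ m + 2 * a i) {μc : (Fin n → ℤ) × ℤ}
    (hμ : (similitudeSatakeTransform hϖ q (heckeAlgebra.doubleCosetOperator (symplecticSimilitudeInt (Fin n) K)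
      (similitudeTorusElt (uniformizer_ne_zero hϖ) m a))).coeff μc ≠ 0) (r : ℕ) :
    (∑ i : Fin n, if (i : ℕ) < r then μc.1 i else 0) ≤ ∑ i : Fin n, if (i : ℕ) < r then m + a i else 0 := by
  by_contra hlt
  refine hμ ((isIwasawaExponent_similitude hϖ).coeff_satakeTransform_doubleCosetOperator_eq_zero _ fun γ hγ heq => ?_)
  have hγ' : (γ.out : symplecticSimilitudeGroup (Fin n) K ⧸ symplecticSimilitudeInt (Fin n) K) ∈
      MulAction.orbit (symplecticSimilitudeInt (Fin n) K)
        ((similitudeTorusElt (uniformizer_ne_zero hϖ) m a : symplecticSimilitudeGroup (Fin n) K) :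
          symplecticSimilitudeGroup (Fin n) K ⧸ symplecticSimilitudeInt (Fin n) K) := by
    rwa [QuotientGroup.out_eq']
  have h := sum_similitudeIwasawaExp_head_le hϖ ha hm hγ' r
  rw [heq] at h
  exact hlt h

/-- **The leading coefficient of `𝒮(T_{t(m, a)})`**, that of `x^{(m + a, m)}`, is non-zero over a domain of characteristic
`0`. [cite: CartierCorvallis1979, §IV, proof of Thm. 4.1 (c)] [cite: BruhatTits1972, Prop. (4.4.4) (ii)] -/
theorem coeff_self_similitudeSatakeTransform_torusElt_ne_zero [IsDomain R] [CharZero R]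
    (hϖ : Valued.v ϖ = WithZero.exp (-1 : ℤ)) (q : Rˣ) (m : ℤ) (a : Fin n → ℤ) :
    (similitudeSatakeTransform hϖ q (heckeAlgebra.doubleCosetOperator (symplecticSimilitudeInt (Fin n) K)
      (similitudeTorusElt (uniformizer_ne_zero hϖ) m a))).coeff (fun i => m + a i, m) ≠ 0 := by
  rw [← similitudeIwasawaExp_similitudeTorusElt hϖ m a]
  exact (isIwasawaExponent_similitude hϖ).coeff_self_satakeTransform_doubleCosetOperator_ne_zero _ _

end Literature.NumberTheory.Automorphic.SymplecticCartan

end
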